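import Mathlib
import HarnessLib
import Literature.Analysis.FluidPDE.SelfSimilar
import Literature.Analysis.FluidPDE.LocalTypeI
import Literature.Analysis.FluidPDE.VectorCalculus
import Literature.Analysis.FluidPDE.OseenMildUniqueness
import Literature.Analysis.Fourier.TitchmarshPaleyWiener
import Literature.Analysis.UnboundedOperators.HeatKernel
import Summits.NavierStokesRegularity.NavierStokesRegularity.Theorems.LocalSineTubeDoorProfileAlignedWindowRigidityAncient
import Summits.NavierStokesRegularity.NavierStokesRegularity.Theorems.PoloidalWindowDoorPoloidalWindowRigiditySubparabolicGradient
import Summits.NavierStokesRegularity.NavierStokesRegularity.Theorems.PoloidalWindowDoorPoloidalWindowRigidityLinePairing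
import Summits.NavierStokesRegularity.NavierStokesRegularity.Theorems.PoloidalWindowDoorPoloidalWindowRigidityLineBandLimited

/-!
# K2 `PoloidalWindowRigidity` (stmt-NavierStokesRegularity-19708) — line `entire_slices`, RUNG `stub_expTypeTH` PROVED:
# no profile of the Type-I class with band-limited horizontal slices on a window is backward-singular at the apex

Seat ns-es-p1 g2 (prover keyed by director-ns KEY-NS #53/#63/#64 to the rung `stub_expTypeTH` of the crux line
`Cruxes/PoloidalWindowRigidity/Lines/entire_slices.lean` v2 (planner ns-idea-8 g0; critic idea-crit-7 PASS-WITH-PRICE, rung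
CLEAN); file `--supports stmt-NavierStokesRegularity-19708`; the statement below is the registered stub VERBATIM, binder for
binder, so the line's `sorry` at `stub_expTypeTH` closes by `exact …Theorems.PoloidalWindowDoorPoloidalWindowRigidityStubExpTypeTH.stub_expTypeTH`).

THE STATEMENT (= binders of `mixed_type`'s `stub_hyperbolicTH` + the exponential-type clause).  A profile `v` of the route's
Type-I class (rate, continuity on the open slab, unit-viscosity Oseen-mild, divergence-free, poloidal), a nonempty open window
`W` of the slab carrying the ND pins, the (TV)-pin, the twist, hyperbolicity and the (TH) slope law, and — the clause that matters —
a uniform Bernstein bound `‖Dⁿ_h v(t)(y)‖ ≤ A bⁿ` of the horizontal restrictions at the points of `W` (horizontal slices entire of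
EXPONENTIAL TYPE `≤ b`) ⇒ `¬ IsBackwardSingularPoint v 0`.

THE PROOF does not use the card's frequency-doubling route (§Prices R1/R2, whose boundary-germ step R2 is not paper-complete) and in
fact uses none of the (TH)/twist/pin/poloidal binders: band-limitation ALONE is incompatible with a singular apex in the class.
  (D) `…LineBandLimited.hasFourierSupportIn_line_of_taylorBound`: at each window point the line restrictions
      `s ↦ v_i(t, y + s e₀)`, `e₀ = (1,0,0)`, are bounded entire functions of exponential type `b`, hence (Phragmén–Lindelöf +
      the tree's PROVED 1-D Paley–Wiener–Schwartz) have distributional Fourier support in `[−b/2π, b/2π]`;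
  (C) `…LinePairing.hasFourierSupportIn_line_of_open`: the pairings `(t,y) ↦ ∫ v_i(t, y + s e₀) 𝓕φ(s) ds` are jointly
      real-analytic on the slab (complexified Oseen scheme of Lemarié-Rieusset 2016 Thm 9.12 as PROVED in the tree, Galilean chart,
      holomorphic parameter integrals, bounded-mild uniqueness), so band-limitation propagates from `W` to EVERY line at EVERY `t < 0`;
  (B) `…LineBandLimited.norm_fderiv_apply_le_of_lineBandLimited_typeI`: Bernstein (PWS forward + Cauchy) and the Type-I rate give
      the SUB-PARABOLIC gradient bound `‖Dv(t)(y) e₀‖ ≤ √3 e^{b} C/√(−t)` on the whole slab;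
  (A) `…SubparabolicGradient.not_backwardSingular_of_fderiv_apply_bound`: such a profile is not backward-singular at `(0,0)`
      (small-slice regularity, or zoom-in + KNSS compactness + the one-slice translation Liouville theorem of the tree).

WHAT THIS IS NOT: not a claim about Navier–Stokes regularity and not the crux `PoloidalWindowRigidity` — the line's load-bearing
stubs `stub_horizontalEntire` (S*), `stub_entireTH`, `stub_entireThick` remain open; this is the FIRST RUNG only (bears_on LADDER-NS N0,
rung N0-LocalTubeDoorPoloidal, crux K2 = stmt-19708).  Consequence worth recording for the planners: the exponential-type clause is
so strong that it kills the apex singularity by itself; the umbrella `stub_entireTH` (entire slices WITHOUT a type bound) is NOT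
reached by this mechanism (no Bernstein inequality without a type bound).  No summit statement is proved here.
-/

noncomputable section

-- the summit and its single sub-problem share the name (CONVENTIONS §1), as in every Theorems file
set_option linter.dupNamespace false

namespace Summit.NavierStokesRegularity.NavierStokesRegularity.Theorems.PoloidalWindowDoorPoloidalWindowRigidityStubExpTypeTH

open Set Function Filter MeasureTheory Metric Topology
open scoped RealInnerProductSpace InnerProductSpace Real
open Literature.Analysis Literature.Analysis.FluidPDE Literature.Analysis.Fourier
open Summit.NavierStokesRegularity.NavierStokesRegularity.Theorems.LocalSineTubeDoorProfileAlignedWindowRigidityAncient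
open Summit.NavierStokesRegularity.NavierStokesRegularity.Theorems.PoloidalWindowDoorPoloidalWindowRigiditySubparabolicGradient
open Summit.NavierStokesRegularity.NavierStokesRegularity.Theorems.PoloidalWindowDoorPoloidalWindowRigidityLinePairing
open Summit.NavierStokesRegularity.NavierStokesRegularity.Theorems.PoloidalWindowDoorPoloidalWindowRigidityLineBandLimited

/-- **RUNG `stub_expTypeTH` of line `entire_slices` (crux K2 `PoloidalWindowRigidity`, stmt-19708), VERBATIM**: a profile of the
Type-I class, poloidal, with a twisting non-degenerate pinned hyperbolic (TH) window on which the horizontal restrictions obey a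
uniform exponential-type bound `‖Dⁿ_h v(t)(y)‖ ≤ A bⁿ`, is not backward-singular at the apex.  Proof: (D) → (C) → (B) → (A) of the
module docstring; only the class binders (rate, continuity, mild, divergence-free), the window `W` (open, nonempty, in the slab) and
the exponential-type clause are used. -/
theorem stub_expTypeTH :
    ∀ (C : ℝ) (v : ℝ → EuclideanSpace ℝ (Fin 3) → EuclideanSpace ℝ (Fin 3)),
      Literature.Analysis.FluidPDE.HasTypeITimeDecay C v →
      ContinuousOn (Function.uncurry v) (Set.Iio (0 : ℝ) ×ˢ Set.univ) →
      (∀ s t : ℝ, s < t → t < 0 → ∀ x, v t x =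
        Literature.Analysis.UnboundedOperators.heatExtension (v s) (t - s) x -
          Literature.Analysis.FluidPDE.oseenDuhamel 1 s v v t x) →
      (∀ t < 0, Literature.Analysis.FluidPDE.VectorCalculus.IsDivFree (v t)) →
      (∀ s < 0, ∀ y, ⟪Literature.Analysis.FluidPDE.curl (v s) y, EuclideanSpace.single 2 1⟫_ℝ = 0) →
      ∀ W : Set (ℝ × EuclideanSpace ℝ (Fin 3)), IsOpen W → W.Nonempty → W ⊆ Set.Iio (0 : ℝ) ×ˢ Set.univ →
        (∀ z ∈ W, Literature.Analysis.FluidPDE.curl (v z.1) z.2 ≠ 0 ∧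
          (fderiv ℝ (v z.1) z.2 (EuclideanSpace.single 0 1) 2 ≠ 0 ∨ fderiv ℝ (v z.1) z.2 (EuclideanSpace.single 1 1) 2 ≠ 0) ∧
          (fderiv ℝ (v z.1) z.2 (EuclideanSpace.single 2 1) 0 ≠ 0 ∨ fderiv ℝ (v z.1) z.2 (EuclideanSpace.single 2 1) 1 ≠ 0)) →
        (∀ m : ℝ → ℝ, ∀ W₁ : Set (ℝ × EuclideanSpace ℝ (Fin 3)), W₁ ⊆ W → IsOpen W₁ → W₁.Nonempty →
          ∃ z ∈ W₁, ∃ b : Fin 3, b ≠ 2 ∧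
            fderiv ℝ (v z.1) z.2 (EuclideanSpace.single 2 1) b ≠
              m z.1 * fderiv ℝ (v z.1) z.2 (EuclideanSpace.single b 1) 2) →
        (∀ z ∈ W,
          fderiv ℝ (fun x => fderiv ℝ (v z.1) x (EuclideanSpace.single 2 1) 2) z.2 (EuclideanSpace.single 0 1) *
              fderiv ℝ (v z.1) z.2 (EuclideanSpace.single 1 1) 2 -
            fderiv ℝ (fun x => fderiv ℝ (v z.1) x (EuclideanSpace.single 2 1) 2) z.2 (EuclideanSpace.single 1 1) *
              fderiv ℝ (v z.1) z.2 (EuclideanSpace.single 0 1) 2 ≠ 0) →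
        (∀ z ∈ W,
          fderiv ℝ (v z.1) z.2 (EuclideanSpace.single 2 1) 0 * fderiv ℝ (v z.1) z.2 (EuclideanSpace.single 0 1) 2 +
            fderiv ℝ (v z.1) z.2 (EuclideanSpace.single 2 1) 1 * fderiv ℝ (v z.1) z.2 (EuclideanSpace.single 1 1) 2 < 0) →
        (∃ m : ℝ → ℝ → ℝ, ∀ z ∈ W, ∀ b : Fin 3, b ≠ 2 →
          fderiv ℝ (v z.1) z.2 (EuclideanSpace.single 2 1) b =
            m z.1 (z.2 2) * fderiv ℝ (v z.1) z.2 (EuclideanSpace.single b 1) 2) →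
        (∃ b A : ℝ, 0 ≤ b ∧ ∀ z ∈ W, ∀ n : ℕ,
          ‖iteratedFDeriv ℝ n (fun p : EuclideanSpace ℝ (Fin 2) =>
              v z.1 (z.2 + (EuclideanSpace.single 0 (p 0) + EuclideanSpace.single 1 (p 1)))) 0‖ ≤
            A * b ^ n) →
        ¬ Literature.Analysis.FluidPDE.IsBackwardSingularPoint v 0 := by
  intro C v hrate hcont hmild hdiv _hpol W hW hWne hWs _hnd _hpin _htw _hhyp _hTH hexp
  obtain ⟨b, A, hb, hA⟩ := hexp
  have hbdd := bdd_of_hasTypeITimeDecay hrate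
  set e₀ : EuclideanSpace ℝ (Fin 3) := EuclideanSpace.single 0 1 with he₀
  -- (D) band-limited line restrictions at the window points
  have hD : ∀ z ∈ W, ∀ i : Fin 3,
      HasFourierSupportIn (fun s : ℝ => ((v z.1 (z.2 + s • e₀) i : ℝ) : ℂ)) (Icc (-(b / (2 * π))) (b / (2 * π))) :=
    fun z hz i => hasFourierSupportIn_line_of_taylorBound hcont hbdd hmild (mem_prod.1 (hWs hz)).1 z.2 hb (hA z hz) i
  -- (C) propagation to every line at every negative time
  have hC : ∀ t < 0, ∀ (y : EuclideanSpace ℝ (Fin 3)) (i : Fin 3),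
      HasFourierSupportIn (fun s : ℝ => ((v t (y + s • e₀) i : ℝ) : ℂ)) (Icc (-(b / (2 * π))) (b / (2 * π))) :=
    fun t ht y i => hasFourierSupportIn_line_of_open hcont hbdd hmild e₀ i _ hW hWne hWs (fun z hz => hD z hz i) t ht y
  -- (B) the sub-parabolic gradient bound along `e₀`
  have hB := norm_fderiv_apply_le_of_lineBandLimited_typeI hrate hcont hmild (e := e₀) (B := b / (2 * π))
    (by positivity) hC
  -- (A) the endgame
  have he₀0 : e₀ ≠ 0 := by
    intro h
    have h0 := congrArg (fun w : EuclideanSpace ℝ (Fin 3) => w 0) h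
    simp [he₀] at h0
  exact not_backwardSingular_of_fderiv_apply_bound hrate hcont hmild hdiv he₀0 hB

end Summit.NavierStokesRegularity.NavierStokesRegularity.Theorems.PoloidalWindowDoorPoloidalWindowRigidityStubExpTypeTH

end
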